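import Literature.MathematicalPhysics.QuantumFieldTheory.Balaban1983to89.B9Thm312WholeLeft
import Literature.MathematicalPhysics.QuantumFieldTheory.Balaban1983to89.B9Thm313Whole

/-!
# `Balaban1983to89.B9Thm312WholeLeafLeftGlob` — [B9] Theorems 3.12 ∕ 3.13 (pp. 423, 426) AS THE WHOLE PRINTED LEAVES
# `B9.Thm312Printed` ∕ `B9.Thm313Printed` AT THE PINS, with the left sup entry (3.42)₂ (G, G₁) and the global entries
# (3.47)ₙ, n ≠ 3, PROVED INSIDE (the family theorems over `…B9Thm312WholeLeft`)

T. Bałaban, *Propagators for lattice gauge theories in a background field*, Commun. Math. Phys. **99** (1985) 389–434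
[`Balaban1985BackgroundPropagators`, "B9"]; [4] = T. Bałaban, *Propagators and renormalization transformations for lattice
gauge theories. II*, Commun. Math. Phys. **96** (1984) 223–250 [`Balaban1984PropagatorsII`].

statement-level skeleton of published theorems with citation tags; proofs where landed; nothing here is a claim about the
Yang–Mills mass gap

THE PRINTED LOCI are those of `…B9Thm312Whole` ∕ `…B9Thm312WholeLeft` (pp. 397–398: (3.41), (3.42), (3.47); pp. 420–426: (3.126),
(3.129), (3.130), (3.138), (3.147), (3.153); Theorem 3.12 p. 423 and Theorem 3.13 p. 426 verbatim there); p. 422: *"This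
inequality [(3.131)] and Theorem 3.3 for G₀ imply a convergence of the series (3.130), for α₀ sufficiently small, in all norms
appearing on the left-hand sides of the inequalities (3.42)–(3.47), except the inequality involving the Laplace operator in
(3.42). Thus we have Theorem 3.3. for G, with this exception."*; p. 398: *"It is easy to see that the global inequalities (3.47)
are consequences of the local ones (3.42) and Lemma 2.1."*

WHAT THIS FILE PROVES (theorems only — 0 `def`, 0 named fact, 0 sorry).  Seat n06-l's g0 leaves `…B9Thm312WholeLeaf.thm312Printed_of_step`
(row 20 of the N06 census) and `…B9Thm313Whole.thm313Printed_of_step` (row 21) DISPLAY, among the residual members `hres`, the left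
sup entry (3.42)₂ and the whole global block (3.47)ₙ, n ≠ 3.  Here, with the SAME conclusions and the SAME pins:
* ★ `thm312Printed_of_stepD` — `B9.Thm312Printed d c35 geo bg GD G₁ Hk H₁k (fun i => HasRWExpOfOps (𝔬 i)) (fun i => HasRWExpHOfOps
  (𝔬 i)) (fun i => PosDefKOfOps (𝔬 i))` from g0's inputs (`hgeo`, `S`, `hrow`, `hco`, `hmodel` VERBATIM) PLUS: `hleft` — per member
  and per U under the printed provisos, `B9Thm312WholeLeft.LeftStep` (Theorem 3.3's (3.42)₂ for G₀ and the derivative of the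
  perturbation step, θ := θ_D·(Mα₀)); `hco1` — the n = 1 co-readings of `GD`, `G₁` by ∇_UG(U), ∇_UG₁(U); `hread` ∕ `hnull` — the glob
  readings of `GD`, `G₁` ON a sub-family `PG i` of arguments (`B9Ineq347Reading.GlobReading`) and the null reading OFF it (n06-h's binder
  shapes); `hL21` — [4] Lemma 2.1 above an M-threshold at every rate δ > 0 with a generic row-sum constant (`Lemma21AboveG`);
  `hL1`, `hLle`, `hη` — 1 ≦ L_i ≦ L, η_i > 0.  PROVED INSIDE: (3.42)₁,₂,₃ for G and G₁ (`entry0_of_step`, ★ `entry1_of_stepD`,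
  `entry2_of_step`) and (3.47)₀,₁,₂ for G and G₁ (`globEntry_of_clause342` at the rate ρ, constant ·c·L⁴), Theorem 3.11 and the pins
  as in g0.  `hres` SHRINKS to the L² block (3.46) and the Hölder block (3.43)–(3.45) for `GD`, `G₁`, and (3.133) for `Hk`, `H₁k`.
* ★ `thm313Printed_of_step_glob` — `B9.Thm313Printed c35 geo bg GG (HasRWExpOfOps) (PosDefKOfOps)` from g0's row-21 inputs (`hgeo`, `S`,
  `hrow`, `hco`, `hmodel`, `hletters` VERBATIM) PLUS `hread` ∕ `hnull` ∕ `hL21` ∕ `hL1` ∕ `hLle` ∕ `hη`; PROVED INSIDE in addition to g0: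
  (3.47)₀ and (3.47)₂ for 𝔊 (from `GG_entry0_of_letters` ∕ `GG_entry2_of_letters` at the rate ρ′).  `hres` of 𝔊 = the two ∇_U𝔊
  members ((3.42)₂ as `Clause342 (GG i) 1 B₁ δ₁ U` and (3.47)₁ displayed — the reduction ∇_U𝔊 = ∇_UG₁𝔓* runs through the mixed
  entry ∇_UG₁D applied to RD*G₁ = RG′D*, which needs a Hölder-class letter, md COROLLARY-H pattern; not typed here), (3.46) and
  (3.43)–(3.45).
The printed quantifiers are met with M₄ := max(M₁, M_L, M_L′), a₀ := min(a₁, (2(θ₁c + 1))⁻¹, (2(r₁ + 1))⁻¹) (q = θ₁(Mα₀)c ≦ ½),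
δ₀ := min(ρ, δ₁) resp. min(ρ′, δ₁), and one constant B₀ above all the proved and displayed ones.

HONEST SCOPE.  Nothing of print is asserted: Theorem 3.3 for G₀ (now with its (3.42)₂ entry), the step majorants and their
derivative, the form bound, the identities, Lemma 2.1, the letters of Theorem 3.13 and the reading axioms are HYPOTHESES of
printed ∕ definitional shape; the residual members listed are NOT proved here.  Value: two more printed members of rows 20–21
moved from «displayed conclusion» to «proved from displayed schemas» — kernel-checked bookkeeping, NOT a node discharge, NOT
summit progress; one finite lattice at a time; nothing continuum, nothing about the mass gap.  Cell `pub-ymgap` (HUMAN RULING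
D-0062), Track A node N06 [B9], N06-ASSIGNMENT v1 rows 20–21 (bundle F7), seat `pub-ymgap-dag-n06-l` (g2), 2026-08-26.
-/

namespace Literature.MathematicalPhysics.QuantumFieldTheory.Balaban1983to89.B9Thm312WholeLeafLeftGlob

open Literature.MathematicalPhysics.QuantumFieldTheory.Balaban1983to89
open Finset B6RandomWalk B6RandomWalkHom B9Thm34Ext B9Thm37GlueCor36 B11SectG B9SectDSup
open B9Thm37AllNorms B9Thm37AllNormsInstances B9FromB6 B9FromB6ModelSignsOn B9SectBStepWhole B9Thm312Whole B9Thm312WholeLeaf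
open B9Thm312WholeLeft B9Thm313Whole

noncomputable section

section Family

variable {I : Type} {d : ℕ} {c35 : ℝ} {geo : I → B9.Geometry} {bg : I → B9.Backgrounds}
variable [∀ i, Fintype (geo i).Site]
variable {X Y Z W : I → Type} [∀ i, Fintype (X i)] [∀ i, DecidableEq (X i)] [∀ i, Fintype (Y i)]
  [∀ i, Fintype (Z i)] [∀ i, Fintype (W i)]

omit [∀ i, Fintype (X i)] [∀ i, DecidableEq (X i)] [∀ i, Fintype (Y i)] [∀ i, Fintype (Z i)] [∀ i, Fintype (W i)]
  [∀ i, Fintype (geo i).Site] in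
/-- **The global block of Theorems 3.12 ∕ 3.13 («n ≠ 3») at one member and one U from the per-entry global inequalities n = 0, 1, 2,
each produced ON the sub-family `PG` at its own constant ≦ B and extended OFF it by the null reading** (bookkeeping over
`B9Thm312WholeLeft.globEntry_all_of_on`). [cite: Balaban1985BackgroundPropagators, Thm 3.12 p.423 + (3.47) p.398] -/
theorem glob_noLap_of_entries {i : I} {P : (geo i).Loc → Prop} (S : ModelSignsOn (geo i) P) {K : B9.KernelFamily (geo i) (bg i)}
    {PG : (geo i).Loc → Prop} {U : (bg i).Cfg} {C₀ C₁ C₂ B : ℝ} (hC₀ : 0 ≤ C₀) (hC₁ : 0 ≤ C₁) (hC₂ : 0 ≤ C₂)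
    (hC₀B : C₀ ≤ B) (hC₁B : C₁ ≤ B) (hC₂B : C₂ ≤ B)
    (h0 : ∀ (lam : (geo i).Loc) (γ : ℝ), PG lam → -4 ≤ γ → γ ≤ 4 → K.glob 0 U lam γ ≤ C₀ * (geo i).wNorm γ lam)
    (h1 : ∀ (lam : (geo i).Loc) (γ : ℝ), PG lam → -4 ≤ γ → γ ≤ 4 → K.glob 1 U lam γ ≤ C₁ * (geo i).wNorm γ lam)
    (h2 : ∀ (lam : (geo i).Loc) (γ : ℝ), PG lam → -4 ≤ γ → γ ≤ 4 → K.glob 2 U lam γ ≤ C₂ * (geo i).wNorm γ lam)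
    (hnull : ∀ (n : Fin 4) (lam : (geo i).Loc) (γ : ℝ), ¬ PG lam → K.glob n U lam γ ≤ 0) :
    ∀ (n : Fin 4) (lam : (geo i).Loc) (γ : ℝ), n ≠ 3 → -4 ≤ γ → γ ≤ 4 → K.glob n U lam γ ≤ B * (geo i).wNorm γ lam := by
  intro n lam γ hn hγ1 hγ2
  have up : ∀ {m : Fin 4} {C : ℝ}, 0 ≤ C → C ≤ B →
      (∀ (lam : (geo i).Loc) (γ : ℝ), PG lam → -4 ≤ γ → γ ≤ 4 → K.glob m U lam γ ≤ C * (geo i).wNorm γ lam) →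
      K.glob m U lam γ ≤ B * (geo i).wNorm γ lam := fun {m} {C} hC hCB h =>
    (globEntry_all_of_on hC S.wNorm_nonneg h (fun lam γ hP => hnull m lam γ hP) lam γ hγ1 hγ2).trans
      (mul_le_mul_of_nonneg_right hCB (S.wNorm_nonneg γ lam))
  fin_cases n
  · exact up hC₀ hC₀B h0
  · exact up hC₁ hC₁B h1
  · exact up hC₂ hC₂B h2
  · exact absurd rfl hn

omit [∀ i, Fintype (X i)] [∀ i, DecidableEq (X i)] [∀ i, Fintype (Y i)] [∀ i, Fintype (Z i)] [∀ i, Fintype (W i)]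
  [∀ i, Fintype (geo i).Site] in
/-- Arithmetic of *"for α₀ sufficiently small"*: t ≧ 0 and m ≦ (2(t + 1))⁻¹ give tm ≦ ½ (the private `small_aux` of
`…B9Thm312WholeLeaf`, re-derived). [folklore] -/
private theorem small_aux' {t m : ℝ} (ht : 0 ≤ t) (hm : m ≤ (2 * (t + 1))⁻¹) : t * m ≤ 1 / 2 := by
  have hpos : 0 < 2 * (t + 1) := by linarith
  have h1 : t * m ≤ t * (2 * (t + 1))⁻¹ := mul_le_mul_of_nonneg_left hm ht
  have h2 : t * (2 * (t + 1))⁻¹ ≤ 1 / 2 := by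
    rw [← div_eq_mul_inv, div_le_iff₀ hpos]
    linarith
  linarith

/-- ★ **THEOREM 3.12 AS THE WHOLE PRINTED LEAF `B9.Thm312Printed`, AT THE PINS, WITH (3.42)₂ AND (3.47)₀,₁,₂ PROVED INSIDE** (p. 423:
*"If an external gauge field configuration U satisfies both regularity conditions (3.35), (3.36) for α₀ sufficiently small, then
Theorems 3.3, 3.10, 3.11 hold for the propagators G, G₁, with one exception and the inequality (3.133) together with Theorem 3.10
hold for the operators H, H₁"*).  The conclusion and the pins are those of g0's `…B9Thm312WholeLeaf.thm312Printed_of_step`, and so are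
the inputs `hgeo`, `S`, `hrow`, `hco`, `hmodel` (Theorem 3.3 for G₀, the steps on 𝔠⁽¹⁾, 𝔠⁽²⁾ at θ₁·(Mα₀), the form bound at r₁·(Mα₀),
the identities, under M ≧ M₁, 0 < α₀, Mα₀ ≦ a₁, (3.35), (3.36)).  NEW INPUTS: `hleft` — `LeftStep` (Theorem 3.3's (3.42)₂ for G₀ and
the derivative of the perturbation steps ∇_UG₀Δ′_π, ∇_UG₀(Δ′_π + Δ⁽²⁾_π) : 𝔠⁽²⁾ → 𝔠_Y⁽¹⁾ at θ_D·(Mα₀), rate δ_K) under the same provisos;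
`hco1` — `CoRealizes (GD i) 1 U blkY blk ev (∇_U ∘ G(U))` and the same for `G₁`; `hread`, `hnull` — the reading axioms
`GlobReading (GD i) (PG i) U (res i)`, `GlobReading (G₁ i) (PG i) U (res i)` and «glob ≦ 0 OFF `PG i`»; `hL21` — for every δ > 0 an
M-threshold and a constant with `Lemma21AboveG geo R₀ H₀ δ α ML′ c′` ((2.60) at α, the row sum at (1−α)δ, 4·log L ≦ αδRM); `hL1`,
`hLle`, `hη`.  RESIDUAL DISPLAYED (`hres`): the L² block (3.46) and the Hölder block (3.43)–(3.45) for `GD`, `G₁` (constants B₁, δ₁,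
B(β), B′(ε), B′(ε,β)) and (3.133) for `Hk`, `H₁k` — NOT proved here.  PROVED INSIDE: (3.42)₁,₂,₃ for G and G₁ at the rate ρ
(constants 2B₀ resp. B₀ + θ_D a₁·2B₀·c after q = θ₁(Mα₀)c ≦ ½), (3.47)₀,₁,₂ for G and G₁ (one scale transfer + one row sum per entry,
constant ·c′·L⁴), Theorem 3.11 for G, G₁, the repaired clause for 𝔊, the convergence pins.  Quantifiers: M₄ := max(M₁, M_L, M_L′),
a₀ := min(a₁, (2(θ₁c + 1))⁻¹, (2(r₁ + 1))⁻¹), δ₀ := min(ρ, δ₁), B₀ := max over the proved and displayed constants and 1.  Nothing of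
print asserted; NOT a node discharge. [cite: Balaban1985BackgroundPropagators, Thm 3.12 pp.421–423 + (3.42) p.397 + (3.47) p.398 + (3.130) p.421 + (3.138) p.423; Balaban1984PropagatorsII, Lemma 2.1 (2.60)–(2.61) p.234] -/
theorem thm312Printed_of_stepD (𝔬 : ∀ i, Ops (geo i) (bg i) (X i) (Y i) (Z i) (W i)) (R₀ : I → ℝ) (H₀ : I → Prop)
    (GD G₁ : ∀ i, B9.KernelFamily (geo i) (bg i)) (Hk H₁k : ∀ i, B9.HKernel (geo i) (bg i))
    (ev : ∀ i, (geo i).Loc → X i → ℝ) (evY : ∀ i, (geo i).Loc → Y i → ℝ) {P : ∀ i, (geo i).Loc → Prop}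
    (PG : ∀ i, (geo i).Loc → Prop) (res : ∀ i, (geo i).Site → (geo i).Loc → (geo i).Loc)
    (θ₁ θD r₁ B₀ δ₀ δK σ c ρ a₁ M₁ ML B₁ δ₁ α Lc : ℝ) (Bβ Bε : ℝ → ℝ) (Bεβ : ℝ → ℝ → ℝ)
    (hθ₁ : 0 ≤ θ₁) (hθD : 0 ≤ θD) (hr₁ : 0 ≤ r₁) (hB₀ : 0 ≤ B₀) (hρ : 0 < ρ) (hρS : ρ ≤ δ₀) (hρδ : ρ + σ ≤ δK)
    (hc : 0 ≤ c) (ha₁ : 0 < a₁) (hM₁ : 0 < M₁) (hδ₁ : 0 < δ₁) (hBβ : ∀ β, 0 ≤ Bβ β) (hBε : ∀ ε, 0 ≤ Bε ε)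
    (hBεβ : ∀ ε β, 0 ≤ Bεβ ε β)
    (hgeo : ∀ i, GeoOK (geo i)) (S : ∀ i, ModelSignsOn (geo i) (P i))
    (hL1 : ∀ i, 1 ≤ (geo i).L) (hLle : ∀ i, (geo i).L ≤ Lc) (hη : ∀ i, 0 < (geo i).eta)
    (hrow : ∀ i, ML ≤ (geo i).M → RowSum (toB6 (geo i) (R₀ i) (H₀ i)) σ c)
    (hL21 : ∀ δ : ℝ, 0 < δ → ∃ ML' c' : ℝ, Lemma21AboveG geo R₀ H₀ δ α ML' c')
    (hco : ∀ (i : I) (U : (bg i).Cfg),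
      CoRealizes (GD i) 0 U (𝔬 i).blk (𝔬 i).blk (ev i) ((𝔬 i).G U) ∧
      CoRealizes (GD i) 2 U (𝔬 i).blk (𝔬 i).blkY (evY i) ((𝔬 i).G U ∘ₗ (𝔬 i).Dstar U) ∧
      CoRealizes (G₁ i) 0 U (𝔬 i).blk (𝔬 i).blk (ev i) ((𝔬 i).G1 U) ∧
      CoRealizes (G₁ i) 2 U (𝔬 i).blk (𝔬 i).blkY (evY i) ((𝔬 i).G1 U ∘ₗ (𝔬 i).Dstar U))
    (hco1 : ∀ (i : I) (U : (bg i).Cfg),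
      CoRealizes (GD i) 1 U (𝔬 i).blkY (𝔬 i).blk (ev i) ((𝔬 i).D U ∘ₗ (𝔬 i).G U) ∧
      CoRealizes (G₁ i) 1 U (𝔬 i).blkY (𝔬 i).blk (ev i) ((𝔬 i).D U ∘ₗ (𝔬 i).G1 U))
    (hread : ∀ (i : I) (U : (bg i).Cfg),
      B9Ineq347Reading.GlobReading (GD i) (PG i) U (res i) ∧ B9Ineq347Reading.GlobReading (G₁ i) (PG i) U (res i))
    (hnull : ∀ (i : I) (U : (bg i).Cfg) (n : Fin 4) (lam : (geo i).Loc) (γ : ℝ), ¬ PG i lam →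
      (GD i).glob n U lam γ ≤ 0 ∧ (G₁ i).glob n U lam γ ≤ 0)
    (hmodel : ∀ i, M₁ ≤ (geo i).M → ∀ α₀ : ℝ, 0 < α₀ → (geo i).M * α₀ ≤ a₁ →
      ∀ U : (bg i).Cfg, (bg i).Reg335 c35 α₀ U → (bg i).Reg336 c35 α₀ U →
        Thm33G0 (𝔬 i) (R₀ i) (H₀ i) B₀ δ₀ U ∧
        Step (𝔬 i) (R₀ i) (H₀ i) (hgeo i).lenle 1 (θ₁ * ((geo i).M * α₀)) δK U ∧
        Step (𝔬 i) (R₀ i) (H₀ i) (hgeo i).lenle 2 (θ₁ * ((geo i).M * α₀)) δK U ∧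
        FormSmall (𝔬 i) (r₁ * ((geo i).M * α₀)) U ∧ Identities (𝔬 i) U)
    (hleft : ∀ i, M₁ ≤ (geo i).M → ∀ α₀ : ℝ, 0 < α₀ → (geo i).M * α₀ ≤ a₁ →
      ∀ U : (bg i).Cfg, (bg i).Reg335 c35 α₀ U → (bg i).Reg336 c35 α₀ U →
        LeftStep (𝔬 i) (R₀ i) (H₀ i) (hgeo i).lenle B₀ δ₀ (θD * ((geo i).M * α₀)) δK U)
    (hres : ∀ i, M₁ ≤ (geo i).M → ∀ α₀ : ℝ, 0 < α₀ → (geo i).M * α₀ ≤ a₁ →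
      ∀ U : (bg i).Cfg, (bg i).Reg335 c35 α₀ U → (bg i).Reg336 c35 α₀ U →
        (∀ K ∈ [GD i, G₁ i], L2Block K B₁ δ₁ U ∧ B9.Ineq343_345 K Bβ Bε Bεβ δ₁ U) ∧
        (∀ Hk' ∈ [Hk i, H₁k i], B9.Ineq3133 d Hk' B₁ Bβ δ₁ U)) :
    B9.Thm312Printed d c35 geo bg GD G₁ Hk H₁k (fun i => HasRWExpOfOps (𝔬 i)) (fun i => HasRWExpHOfOps (𝔬 i))
      (fun i => PosDefKOfOps (𝔬 i)) := by
  -- the constants of the leaf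
  obtain ⟨MLg, cg, hLg⟩ := hL21 ρ hρ
  set cg' : ℝ := max cg 0 with hcg'
  have hcg'0 : 0 ≤ cg' := le_max_right _ _
  set a₀ : ℝ := min a₁ (min (2 * (θ₁ * c + 1))⁻¹ (2 * (r₁ + 1))⁻¹) with ha₀
  set BL : ℝ := B₀ + θD * a₁ * (2 * B₀) * c with hBL
  set Bsup : ℝ := max (2 * B₀) BL with hBsup
  set Bgl : ℝ := Bsup * cg' * Lc ^ (4 : ℝ) with hBgl
  set Bout : ℝ := max (max (max Bsup Bgl) B₁) 1 with hBout
  set δout : ℝ := min ρ δ₁ with hδout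
  have ha₀pos : 0 < a₀ := lt_min ha₁ (lt_min (inv_pos.mpr (by nlinarith)) (inv_pos.mpr (by linarith)))
  have hBsup2 : 2 * B₀ ≤ Bsup := le_max_left _ _
  have hBsupL : BL ≤ Bsup := le_max_right _ _
  have hBsup0 : 0 ≤ Bsup := le_trans (by linarith) hBsup2
  have hBoutS : Bsup ≤ Bout := ((le_max_left _ _).trans (le_max_left _ _)).trans (le_max_left _ _)
  have hBoutG : Bgl ≤ Bout := ((le_max_right _ _).trans (le_max_left _ _)).trans (le_max_left _ _)
  have hBoutB₁ : B₁ ≤ Bout := (le_max_right _ _).trans (le_max_left _ _)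
  have hBout0 : 0 ≤ Bout := zero_le_one.trans (le_max_right _ _)
  have hδρ : δout ≤ ρ := min_le_left _ _
  have hδδ₁ : δout ≤ δ₁ := min_le_right _ _
  refine ⟨max (max M₁ ML) MLg, δout, a₀, Bout, Bβ, Bε, Bεβ, lt_max_of_lt_left (lt_max_of_lt_left hM₁), lt_min hρ hδ₁,
    ha₀pos, zero_lt_one.trans_le (le_max_right _ _), ?_⟩
  intro i hM α₀ hα₀ hMa U hU hU'
  have hM₁i : M₁ ≤ (geo i).M := ((le_max_left _ _).trans (le_max_left _ _)).trans hM
  have hMLi : ML ≤ (geo i).M := ((le_max_right _ _).trans (le_max_left _ _)).trans hM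
  have hMLgi : MLg ≤ (geo i).M := (le_max_right _ _).trans hM
  have hMpos : 0 < (geo i).M := hM₁.trans_le hM₁i
  have hm0 : 0 ≤ (geo i).M * α₀ := (mul_pos hMpos hα₀).le
  have hma₁ : (geo i).M * α₀ ≤ a₁ := hMa.trans (min_le_left _ _)
  have hmθ : (geo i).M * α₀ ≤ (2 * (θ₁ * c + 1))⁻¹ := hMa.trans ((min_le_right _ _).trans (min_le_left _ _))
  have hmr : (geo i).M * α₀ ≤ (2 * (r₁ + 1))⁻¹ := hMa.trans ((min_le_right _ _).trans (min_le_right _ _))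
  obtain ⟨h33, hS1, hS2, hF, hI⟩ := hmodel i hM₁i α₀ hα₀ hma₁ U hU hU'
  have hLS := hleft i hM₁i α₀ hα₀ hma₁ U hU hU'
  obtain ⟨hresK, hresH⟩ := hres i hM₁i α₀ hα₀ hma₁ U hU hU'
  have hrowi := hrow i hMLi
  obtain ⟨h260, hrowg, hsize⟩ := hLg i hMLgi
  have hrowg' : RowSum (toB6 (geo i) (R₀ i) (H₀ i)) ((1 - α) * ρ) cg' := fun y => (hrowg y).trans (le_max_left _ _)
  set θ : ℝ := θ₁ * ((geo i).M * α₀) with hθdef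
  set θ' : ℝ := θD * ((geo i).M * α₀) with hθ'def
  have hθ : 0 ≤ θ := mul_nonneg hθ₁ hm0
  have hθ' : 0 ≤ θ' := mul_nonneg hθD hm0
  have hq : θ * c ≤ 1 / 2 := by
    have h := small_aux' (mul_nonneg hθ₁ hc) hmθ
    calc θ * c = θ₁ * c * ((geo i).M * α₀) := by rw [hθdef]; ring
      _ ≤ 1 / 2 := h
  have hq1 : θ * c < 1 := lt_one_of_le_half hq
  have hr : r₁ * ((geo i).M * α₀) < 1 := by
    have h := small_aux' hr₁ hmr
    linarith
  have hσδ : σ ≤ δK := by linarith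
  have hinv0 : 0 ≤ (1 - θ * c)⁻¹ := inv_nonneg.mpr (by linarith)
  have hC0 : 0 ≤ B₀ * (1 - θ * c)⁻¹ := mul_nonneg hB₀ hinv0
  have hCle : B₀ * (1 - θ * c)⁻¹ ≤ Bsup := (const_le_two_mul hB₀ hq).trans hBsup2
  have hC1 : 0 ≤ B₀ + θ' * (B₀ * (1 - θ * c)⁻¹) * c := add_nonneg hB₀ (mul_nonneg (mul_nonneg hθ' hC0) hc)
  have hC1le : B₀ + θ' * (B₀ * (1 - θ * c)⁻¹) * c ≤ Bsup := by
    have h1 : θ' ≤ θD * a₁ := mul_le_mul_of_nonneg_left hma₁ hθD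
    have h2 : θ' * (B₀ * (1 - θ * c)⁻¹) ≤ θD * a₁ * (2 * B₀) :=
      mul_le_mul h1 (const_le_two_mul hB₀ hq) hC0 (mul_nonneg hθD ha₁.le)
    have h3 : θ' * (B₀ * (1 - θ * c)⁻¹) * c ≤ θD * a₁ * (2 * B₀) * c := mul_le_mul_of_nonneg_right h2 hc
    have h4 : B₀ + θ' * (B₀ * (1 - θ * c)⁻¹) * c ≤ BL := by rw [hBL]; linarith
    exact h4.trans hBsupL
  have hfix := fix_of_inverses hI.invG0' hI.invG
  have hfix1 := fix_of_inverses hI.invG0' hI.invG1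
  obtain ⟨hcoG0, hcoG2, hcoG10, hcoG12⟩ := hco i U
  obtain ⟨hcoG1, hcoG11⟩ := hco1 i U
  obtain ⟨hRD, hR1⟩ := hread i U
  have hlen := (hgeo i).lenle
  -- the proved clauses (3.42)₁,₂,₃ at the rate ρ with the one constant Bsup
  have mono : ∀ {K : B9.KernelFamily (geo i) (bg i)} {n : Fin 4} {C : ℝ}, Clause342 K n C ρ U → 0 ≤ C → C ≤ Bsup →
      Clause342 K n Bsup ρ U := fun h h0 hle =>
    clause342_mono h h0 hle le_rfl (S i).dist_nonneg hlen (S i).supNorm_nonneg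
  have clG0 : Clause342 (GD i) 0 Bsup ρ U := mono (clause342_e0_of_hasMajorant hcoG0
    (entry0_of_step (hgeo i) hrowi hθ hB₀ hρ.le hρS hρδ hS2.step h33.e0 hfix hq1) hC0 hlen) hC0 hCle
  have clG1 : Clause342 (GD i) 1 Bsup ρ U := mono (clause342_e1_of_hasMajorantHom hcoG1
    (entry1_of_stepD (hgeo i) hrowi hθ hθ' hB₀ hρ.le hρS hρδ hS2.step hLS.stepD h33.e0 hLS.e1 hfix hq1) hC1 hlen) hC1 hC1le
  have clG2 : Clause342 (GD i) 2 Bsup ρ U := mono (clause342_e2_of_hasMajorantHom hcoG2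
    (entry2_of_step (hgeo i) hrowi hθ hB₀ hρ.le hρS hρδ hS1.step h33.e2 hfix hq1) hC0 hlen) hC0 hCle
  have clG10 : Clause342 (G₁ i) 0 Bsup ρ U := mono (clause342_e0_of_hasMajorant hcoG10
    (entry0_of_step (hgeo i) hrowi hθ hB₀ hρ.le hρS hρδ hS2.step1 h33.e0 hfix1 hq1) hC0 hlen) hC0 hCle
  have clG11 : Clause342 (G₁ i) 1 Bsup ρ U := mono (clause342_e1_of_hasMajorantHom hcoG11
    (entry1_of_stepD (hgeo i) hrowi hθ hθ' hB₀ hρ.le hρS hρδ hS2.step1 hLS.stepD1 h33.e0 hLS.e1 hfix1 hq1) hC1 hlen)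
    hC1 hC1le
  have clG12 : Clause342 (G₁ i) 2 Bsup ρ U := mono (clause342_e2_of_hasMajorantHom hcoG12
    (entry2_of_step (hgeo i) hrowi hθ hB₀ hρ.le hρS hρδ hS1.step1 h33.e2 hfix1 hq1) hC0 hlen) hC0 hCle
  -- the global entries (3.47)₀,₁,₂: one scale transfer and one row sum per entry, constant Bsup·c′·L⁴ ≦ Bout
  have hL0i : 0 < (geo i).L := lt_of_lt_of_le one_pos (hL1 i)
  have hL4 : (geo i).L ^ (4 : ℝ) ≤ Lc ^ (4 : ℝ) := Real.rpow_le_rpow hL0i.le (hLle i) (by norm_num)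
  have hCgl0 : 0 ≤ Bsup * cg' * (geo i).L ^ (4 : ℝ) := mul_nonneg (mul_nonneg hBsup0 hcg'0) (Real.rpow_nonneg hL0i.le _)
  have hCglle : Bsup * cg' * (geo i).L ^ (4 : ℝ) ≤ Bout :=
    (mul_le_mul_of_nonneg_left hL4 (mul_nonneg hBsup0 hcg'0)).trans hBoutG
  have globK : ∀ {K : B9.KernelFamily (geo i) (bg i)}, B9Ineq347Reading.GlobReading K (PG i) U (res i) →
      (∀ (n : Fin 4) (lam : (geo i).Loc) (γ : ℝ), ¬ PG i lam → K.glob n U lam γ ≤ 0) →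
      Clause342 K 0 Bsup ρ U → Clause342 K 1 Bsup ρ U → Clause342 K 2 Bsup ρ U →
      ∀ (n : Fin 4) (lam : (geo i).Loc) (γ : ℝ), n ≠ 3 → -4 ≤ γ → γ ≤ 4 →
        K.glob n U lam γ ≤ Bout * (geo i).wNorm γ lam := fun {K} hR hnl c0 c1 c2 =>
    glob_noLap_of_entries (S i) hCgl0 hCgl0 hCgl0 hCglle hCglle hCglle
      (globEntry_of_clause342 hR 0 hBsup0 hcg'0 (hL1 i) (hη i) (S i).wNorm_nonneg hsize h260 hrowg' c0)
      (globEntry_of_clause342 hR 1 hBsup0 hcg'0 (hL1 i) (hη i) (S i).wNorm_nonneg hsize h260 hrowg' c1)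
      (globEntry_of_clause342 hR 2 hBsup0 hcg'0 (hL1 i) (hη i) (S i).wNorm_nonneg hsize h260 hrowg' c2) hnl
  -- the residual members, brought to (Bout, δout)
  have resK : ∀ K : B9.KernelFamily (geo i) (bg i), K ∈ [GD i, G₁ i] → Clause342 K 0 Bsup ρ U → Clause342 K 1 Bsup ρ U →
      Clause342 K 2 Bsup ρ U → B9Ineq347Reading.GlobReading K (PG i) U (res i) →
      (∀ (n : Fin 4) (lam : (geo i).Loc) (γ : ℝ), ¬ PG i lam → K.glob n U lam γ ≤ 0) →
      B9.Ineq342_346_347_noLap K Bout δout U ∧ B9.Ineq343_345 K Bβ Bε Bεβ δout U ∧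
        HasRWExpOfOps (𝔬 i) K U δout ∧ PosDefKOfOps (𝔬 i) K U := by
    intro K hK c0 c1 c2 hR hnl
    obtain ⟨hl2, hho⟩ := hresK K hK
    have w : ∀ {m : Fin 4}, Clause342 K m Bsup ρ U → Clause342 K m Bout δout U := fun cm =>
      clause342_mono cm hBsup0 hBoutS hδρ (S i).dist_nonneg hlen (S i).supNorm_nonneg
    exact ⟨⟨eNoLap_of_clauses (w c0) (w c1) (w c2), l2Block_mono (S i) hl2 hBoutB₁ hBout0 hδδ₁, globK hR hnl c0 c1 c2⟩,
      ineq343_345_mono (S i) hho (fun _ => le_rfl) hBβ (fun _ => le_rfl) hBε (fun _ _ => le_rfl) hBεβ hδδ₁,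
      hasRWExp_of_schemas (hgeo i) hrowi hθ hσδ hq1 hS2 hI K δout, posDefK_of_schemas hr hF hI K⟩
  refine ⟨fun K hK => ?_, fun Hk' hK' => ?_⟩
  · have hK2 : K = GD i ∨ K = G₁ i := by simpa using hK
    rcases hK2 with rfl | rfl
    · exact resK _ hK clG0 clG1 clG2 hRD (fun n lam γ hP => (hnull i U n lam γ hP).1)
    · exact resK _ hK clG10 clG11 clG12 hR1 (fun n lam γ hP => (hnull i U n lam γ hP).2)
  · exact ⟨ineq3133_mono (S i) d (hresH Hk' hK') hBoutB₁ hBout0 hBβ hδδ₁,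
      hasRWExpH_of_schemas (hgeo i) hrowi hθ hσδ hq1 hS2 hI Hk' δout⟩

/-- ★ **THEOREM 3.13 AS THE WHOLE PRINTED LEAF `B9.Thm313Printed`, AT THE PINS OF THEOREM 3.12, WITH (3.47)₀ AND (3.47)₂ OF 𝔊 PROVED
INSIDE** (p. 426: *"Especially for 𝔊 we have, assuming (3.132) Theorem 3.13. If an external gauge field configuration U satisfies the
regularity conditions (3.35), (3.36) for α₀ sufficiently small, then Theorems 3.3, 3.10, 3.11 hold for the propagator 𝔊, with the exception
of the inequality in (3.42) involving the covariant Laplace operator"*).  Conclusion, pins and the inputs `hgeo`, `S`, `hrow`, `hco`, `hmodel`,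
`hletters` are those of g0's `…B9Thm313Whole.thm313Printed_of_step`; NEW INPUTS: `hread` ∕ `hnull` (the glob readings of `GG` ON `PG i` and
the null OFF it), `hL21` ([4] Lemma 2.1 above a threshold at every rate, generic constant), `hL1`, `hLle`, `hη`.  PROVED INSIDE: (3.42)₁,₃
for 𝔊 (`GG_entry0_of_letters`, `GG_entry2_of_letters`), (3.47)₀ and (3.47)₂ for 𝔊 at the rate ρ′ (`globEntry_of_clause342`), the two pins.
RESIDUAL DISPLAYED (`hres`): the two ∇_U𝔊 members — (3.42)₂ (`Clause342 (GG i) 1 B₁ δ₁ U`) and (3.47)₁ (the reduction ∇_U𝔊 = ∇_UG₁𝔓*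
needs the mixed entry ∇_UG₁D on the Hölder-class output of RD*G₁ = RG′D*, md COROLLARY-H pattern — not typed here) —, the L² block
(3.46) and the Hölder block (3.43)–(3.45).  Quantifiers: M₄ := max(M₁, M_L, M_L′), a₀ as in Theorem 3.12, δ₀ := min(ρ′, δ₁), one
constant above `const313 (2B₀) (2B₃) B₃ c`, its ·c′·L⁴ multiple, B₁ and 1.  Nothing of print asserted; NOT a node discharge.
[cite: Balaban1985BackgroundPropagators, Thm 3.13 p.426 + (3.153) p.426 + (3.138) p.423 + (3.47) p.398; Balaban1984PropagatorsII, Lemma 2.1 (2.60)–(2.61) p.234] -/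
theorem thm313Printed_of_step_glob (𝔬 : ∀ i, Ops (geo i) (bg i) (X i) (Y i) (Z i) (W i)) (R₀ : I → ℝ) (H₀ : I → Prop)
    (GG : ∀ i, B9.KernelFamily (geo i) (bg i))
    (ev : ∀ i, (geo i).Loc → X i → ℝ) (evY : ∀ i, (geo i).Loc → Y i → ℝ) {P : ∀ i, (geo i).Loc → Prop}
    (PG : ∀ i, (geo i).Loc → Prop) (res : ∀ i, (geo i).Site → (geo i).Loc → (geo i).Loc)
    (θ₁ r₁ B₀ δ₀ δK σ c ρ a₁ M₁ ML B₁ δ₁ B₃ δ₃ ρ' α Lc : ℝ) (Bβ Bε : ℝ → ℝ) (Bεβ : ℝ → ℝ → ℝ)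
    (hθ₁ : 0 ≤ θ₁) (hr₁ : 0 ≤ r₁) (hB₀ : 0 ≤ B₀) (hB₃ : 0 ≤ B₃) (hσ : 0 ≤ σ) (hρ' : 0 < ρ') (hρ'ρ : ρ' + 3 * σ ≤ ρ)
    (hρS : ρ ≤ δ₀) (hρ₃ : ρ ≤ δ₃) (hρδ : ρ + σ ≤ δK) (hc : 0 ≤ c) (ha₁ : 0 < a₁) (hM₁ : 0 < M₁) (hB₁ : 0 ≤ B₁) (hδ₁ : 0 < δ₁)
    (hBβ : ∀ β, 0 ≤ Bβ β) (hBε : ∀ ε, 0 ≤ Bε ε) (hBεβ : ∀ ε β, 0 ≤ Bεβ ε β)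
    (hgeo : ∀ i, GeoOK (geo i)) (S : ∀ i, ModelSignsOn (geo i) (P i))
    (hL1 : ∀ i, 1 ≤ (geo i).L) (hLle : ∀ i, (geo i).L ≤ Lc) (hη : ∀ i, 0 < (geo i).eta)
    (hrow : ∀ i, ML ≤ (geo i).M → RowSum (toB6 (geo i) (R₀ i) (H₀ i)) σ c)
    (hL21 : ∀ δ : ℝ, 0 < δ → ∃ ML' c' : ℝ, Lemma21AboveG geo R₀ H₀ δ α ML' c')
    (hco : ∀ (i : I) (U : (bg i).Cfg),
      CoRealizes (GG i) 0 U (𝔬 i).blk (𝔬 i).blk (ev i) ((𝔬 i).GG U) ∧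
      CoRealizes (GG i) 2 U (𝔬 i).blk (𝔬 i).blkY (evY i) ((𝔬 i).GG U ∘ₗ (𝔬 i).Dstar U))
    (hread : ∀ (i : I) (U : (bg i).Cfg), B9Ineq347Reading.GlobReading (GG i) (PG i) U (res i))
    (hnull : ∀ (i : I) (U : (bg i).Cfg) (n : Fin 4) (lam : (geo i).Loc) (γ : ℝ), ¬ PG i lam → (GG i).glob n U lam γ ≤ 0)
    (hmodel : ∀ i, M₁ ≤ (geo i).M → ∀ α₀ : ℝ, 0 < α₀ → (geo i).M * α₀ ≤ a₁ →
      ∀ U : (bg i).Cfg, (bg i).Reg335 c35 α₀ U → (bg i).Reg336 c35 α₀ U →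
        Thm33G0 (𝔬 i) (R₀ i) (H₀ i) B₀ δ₀ U ∧
        Step (𝔬 i) (R₀ i) (H₀ i) (hgeo i).lenle 1 (θ₁ * ((geo i).M * α₀)) δK U ∧
        Step (𝔬 i) (R₀ i) (H₀ i) (hgeo i).lenle 2 (θ₁ * ((geo i).M * α₀)) δK U ∧
        FormSmall (𝔬 i) (r₁ * ((geo i).M * α₀)) U ∧ Identities (𝔬 i) U)
    (hletters : ∀ i, M₁ ≤ (geo i).M → ∀ α₀ : ℝ, 0 < α₀ → (geo i).M * α₀ ≤ a₁ →
      ∀ U : (bg i).Cfg, (bg i).Reg335 c35 α₀ U → (bg i).Reg336 c35 α₀ U →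
        Letters313 (𝔬 i) (R₀ i) (H₀ i) (hgeo i) B₃ δ₃ U)
    (hres : ∀ i, M₁ ≤ (geo i).M → ∀ α₀ : ℝ, 0 < α₀ → (geo i).M * α₀ ≤ a₁ →
      ∀ U : (bg i).Cfg, (bg i).Reg335 c35 α₀ U → (bg i).Reg336 c35 α₀ U →
        Clause342 (GG i) 1 B₁ δ₁ U ∧
          (∀ (lam : (geo i).Loc) (γ : ℝ), -4 ≤ γ → γ ≤ 4 → (GG i).glob 1 U lam γ ≤ B₁ * (geo i).wNorm γ lam) ∧
          L2Block (GG i) B₁ δ₁ U ∧ B9.Ineq343_345 (GG i) Bβ Bε Bεβ δ₁ U) :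
    B9.Thm313Printed c35 geo bg GG (fun i => HasRWExpOfOps (𝔬 i)) (fun i => PosDefKOfOps (𝔬 i)) := by
  -- the constants of the leaf
  obtain ⟨MLg, cg, hLg⟩ := hL21 ρ' hρ'
  set cg' : ℝ := max cg 0 with hcg'
  have hcg'0 : 0 ≤ cg' := le_max_right _ _
  set a₀ : ℝ := min a₁ (min (2 * (θ₁ * c + 1))⁻¹ (2 * (r₁ + 1))⁻¹) with ha₀
  set C₂ : ℝ := const313 (2 * B₀) (2 * B₃) B₃ c with hC₂
  set Cgl : ℝ := C₂ * cg' * Lc ^ (4 : ℝ) with hCgl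
  set Bout : ℝ := max (max (max C₂ Cgl) B₁) 1 with hBout
  set δout : ℝ := min ρ' δ₁ with hδout
  have ha₀pos : 0 < a₀ := lt_min ha₁ (lt_min (inv_pos.mpr (by nlinarith)) (inv_pos.mpr (by linarith)))
  have hC₂0 : 0 ≤ C₂ := const313_nonneg (by linarith) (by linarith) hB₃ hc
  have hBoutC : C₂ ≤ Bout := ((le_max_left _ _).trans (le_max_left _ _)).trans (le_max_left _ _)
  have hBoutG : Cgl ≤ Bout := ((le_max_right _ _).trans (le_max_left _ _)).trans (le_max_left _ _)
  have hBoutB₁ : B₁ ≤ Bout := (le_max_right _ _).trans (le_max_left _ _)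
  have hBout0 : 0 ≤ Bout := zero_le_one.trans (le_max_right _ _)
  have hδρ : δout ≤ ρ' := min_le_left _ _
  have hδδ₁ : δout ≤ δ₁ := min_le_right _ _
  refine ⟨max (max M₁ ML) MLg, δout, a₀, Bout, Bβ, Bε, Bεβ, lt_max_of_lt_left (lt_max_of_lt_left hM₁), lt_min hρ' hδ₁,
    ha₀pos, zero_lt_one.trans_le (le_max_right _ _), ?_⟩
  intro i hM α₀ hα₀ hMa U hU hU'
  have hM₁i : M₁ ≤ (geo i).M := ((le_max_left _ _).trans (le_max_left _ _)).trans hM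
  have hMLi : ML ≤ (geo i).M := ((le_max_right _ _).trans (le_max_left _ _)).trans hM
  have hMLgi : MLg ≤ (geo i).M := (le_max_right _ _).trans hM
  have hMpos : 0 < (geo i).M := hM₁.trans_le hM₁i
  have hm0 : 0 ≤ (geo i).M * α₀ := (mul_pos hMpos hα₀).le
  have hma₁ : (geo i).M * α₀ ≤ a₁ := hMa.trans (min_le_left _ _)
  have hmθ : (geo i).M * α₀ ≤ (2 * (θ₁ * c + 1))⁻¹ := hMa.trans ((min_le_right _ _).trans (min_le_left _ _))
  have hmr : (geo i).M * α₀ ≤ (2 * (r₁ + 1))⁻¹ := hMa.trans ((min_le_right _ _).trans (min_le_right _ _))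
  obtain ⟨h33, hS1, hS2, hF, hI⟩ := hmodel i hM₁i α₀ hα₀ hma₁ U hU hU'
  have hL := hletters i hM₁i α₀ hα₀ hma₁ U hU hU'
  obtain ⟨c1, hgl1, hl2, hho⟩ := hres i hM₁i α₀ hα₀ hma₁ U hU hU'
  have hrowi := hrow i hMLi
  obtain ⟨h260, hrowg, hsize⟩ := hLg i hMLgi
  have hrowg' : RowSum (toB6 (geo i) (R₀ i) (H₀ i)) ((1 - α) * ρ') cg' := fun y => (hrowg y).trans (le_max_left _ _)
  set θ : ℝ := θ₁ * ((geo i).M * α₀) with hθdef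
  have hθ : 0 ≤ θ := mul_nonneg hθ₁ hm0
  have hq : θ * c ≤ 1 / 2 := by
    have h := small_aux' (mul_nonneg hθ₁ hc) hmθ
    calc θ * c = θ₁ * c * ((geo i).M * α₀) := by rw [hθdef]; ring
      _ ≤ 1 / 2 := h
  have hq1 : θ * c < 1 := lt_one_of_le_half hq
  have hr : r₁ * ((geo i).M * α₀) < 1 := by
    have h := small_aux' hr₁ hmr
    linarith
  have hσδ : σ ≤ δK := by linarith
  have hinv0 : 0 ≤ (1 - θ * c)⁻¹ := inv_nonneg.mpr (by linarith)
  have hA₁ : 0 ≤ B₀ * (1 - θ * c)⁻¹ := mul_nonneg hB₀ hinv0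
  have hA₃ : 0 ≤ B₃ * (1 - θ * c)⁻¹ := mul_nonneg hB₃ hinv0
  have hC0 : 0 ≤ const313 (B₀ * (1 - θ * c)⁻¹) (B₃ * (1 - θ * c)⁻¹) B₃ c := const313_nonneg hA₁ hA₃ hB₃ hc
  have hCle : const313 (B₀ * (1 - θ * c)⁻¹) (B₃ * (1 - θ * c)⁻¹) B₃ c ≤ C₂ :=
    const313_mono hA₁ (const_le_two_mul hB₀ hq) hA₃ (const_le_two_mul hB₃ hq) hB₃ hc
  obtain ⟨hco0, hco2⟩ := hco i U
  have hR := hread i U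
  have hlen := (hgeo i).lenle
  -- the proved clauses (3.42)₁,₃ of 𝔊 at the rate ρ′ with the constant C₂
  have cl0 : Clause342 (GG i) 0 C₂ ρ' U :=
    clause342_mono (clause342_e0_of_hasMajorant hco0
      (GG_entry0_of_letters (hgeo i) hrowi hc hθ hB₀ hB₃ hσ hρ'.le hρ'ρ hρS hρ₃ hρδ hq1 hS2.step1 h33.e0 hL hI) hC0 hlen)
      hC0 hCle le_rfl (S i).dist_nonneg hlen (S i).supNorm_nonneg
  have cl2 : Clause342 (GG i) 2 C₂ ρ' U :=
    clause342_mono (clause342_e2_of_hasMajorantHom hco2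
      (GG_entry2_of_letters (hgeo i) hrowi hc hθ hB₀ hB₃ hσ hρ'.le hρ'ρ hρS hρ₃ hρδ hq1 hS1.step1 h33.e2 hL hI) hC0 hlen)
      hC0 hCle le_rfl (S i).dist_nonneg hlen (S i).supNorm_nonneg
  -- the global entries (3.47)₀, (3.47)₂ of 𝔊, constant C₂·c′·L⁴ ≦ Bout; (3.47)₁ displayed at B₁ ≦ Bout
  have hL0i : 0 < (geo i).L := lt_of_lt_of_le one_pos (hL1 i)
  have hL4 : (geo i).L ^ (4 : ℝ) ≤ Lc ^ (4 : ℝ) := Real.rpow_le_rpow hL0i.le (hLle i) (by norm_num)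
  have hCgl0 : 0 ≤ C₂ * cg' * (geo i).L ^ (4 : ℝ) := mul_nonneg (mul_nonneg hC₂0 hcg'0) (Real.rpow_nonneg hL0i.le _)
  have hCglle : C₂ * cg' * (geo i).L ^ (4 : ℝ) ≤ Bout := (mul_le_mul_of_nonneg_left hL4 (mul_nonneg hC₂0 hcg'0)).trans hBoutG
  have hglob : ∀ (n : Fin 4) (lam : (geo i).Loc) (γ : ℝ), n ≠ 3 → -4 ≤ γ → γ ≤ 4 →
      (GG i).glob n U lam γ ≤ Bout * (geo i).wNorm γ lam :=
    glob_noLap_of_entries (S i) hCgl0 hB₁ hCgl0 hCglle hBoutB₁ hCglle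
      (globEntry_of_clause342 hR 0 hC₂0 hcg'0 (hL1 i) (hη i) (S i).wNorm_nonneg hsize h260 hrowg' cl0)
      (fun lam γ _ h1 h2 => hgl1 lam γ h1 h2)
      (globEntry_of_clause342 hR 2 hC₂0 hcg'0 (hL1 i) (hη i) (S i).wNorm_nonneg hsize h260 hrowg' cl2) (hnull i U)
  -- everything brought to (Bout, δout)
  have w0 : Clause342 (GG i) 0 Bout δout U := clause342_mono cl0 hC₂0 hBoutC hδρ (S i).dist_nonneg hlen (S i).supNorm_nonneg
  have w2 : Clause342 (GG i) 2 Bout δout U := clause342_mono cl2 hC₂0 hBoutC hδρ (S i).dist_nonneg hlen (S i).supNorm_nonneg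
  have w1 : Clause342 (GG i) 1 Bout δout U := clause342_mono c1 hB₁ hBoutB₁ hδδ₁ (S i).dist_nonneg hlen (S i).supNorm_nonneg
  exact ⟨⟨eNoLap_of_clauses w0 w1 w2, l2Block_mono (S i) hl2 hBoutB₁ hBout0 hδδ₁, hglob⟩,
    ineq343_345_mono (S i) hho (fun _ => le_rfl) hBβ (fun _ => le_rfl) hBε (fun _ _ => le_rfl) hBεβ hδδ₁,
    hasRWExp_of_schemas (hgeo i) hrowi hθ hσδ hq1 hS2 hI (GG i) δout, posDefK_of_schemas hr hF hI (GG i)⟩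

end Family

end

end Literature.MathematicalPhysics.QuantumFieldTheory.Balaban1983to89.B9Thm312WholeLeafLeftGlob
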